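import Literature.NumberTheory.Li1992.RallisLocalFactorSplitUnramified
import Literature.NumberTheory.Automorphic.Liu2021.Def411WeilCarriersSurvivalSplit
import HarnessLib

/-!
# [Li1992, Thm 2.1 (27)] — the split unramified local factor from a GENERATOR of `U(J₁)(F_v) ∕ U(J₁)(𝒪_v)`: the coset bookkeeping

J.-S. Li, J. reine angew. Math. **428** (1992), Thm 2.1 (27) p. 184; J. Tate, in Cassels–Fröhlich (1967), §3.2.  Sequel of
`RallisLocalFactorSplitUnramified.lean`, whose hypotheses `hcover`/`hfree` («`U(J₁)(F_v) = ⊔_m z₀^m U(J₁)(𝒪_v)`, disjointly») are here DERIVED from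
the shape in which the tree supplies a local generator at a split place — `hz₀ : ∀ h, ∃ k₀ m, k₀ ∈ U(J₁)(𝒪_v) ∧ h = k₀ z₀^m` together with the
valuation of the `w`-coordinate of `z₀` being `q_w^{∓1}` (★ `LocalUnitarySplitPlaceDarboux.valued_entry_eq_exp_or_of_generates`):

* `exists_zpow_inv_mul_mem_of_generates` — `hcover` (the torus `U(J₁)(F_v)` is commutative);
* `zpow_mem_localInt_imp_eq_zero` — `hfree`: `z₀^m ∈ U(J₁)(𝒪_v) ⇒ m = 0` (the `w`-entry of an integral element has valuation `1`,
  ★ `valued_det_eq_one_iff_mem_glInt_one`, while that of `z₀^m` is `q_w^{∓m}`);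
* **`integral_localFactor_unitVec_ne_zero_of_generates`** — the split unramified LOCAL FACTOR at the spherical data
  `∫_{U(J₁)(F_v)} ⟨ω_v(h·1)1_{𝒪ᴺ},1_{𝒪ᴺ}⟩ conj χ_v(h) dh = dh(U(J₁)(𝒪_v)) · C · (1 − r²) ∕ |1 − u conj χ_v(z₀) r|² ≠ 0` for a generator `z₀`
  of valuation `q_w^{∓1}`, GIVEN the spherical matrix coefficients `C u^m r^{|m|}` (★ `FinLocalSplittingsSplitSphericalCoeff(Darboux)`:
  `C = μ(𝒪_vᴺ)`, `r = q_v^{-N/2}`), `1_{𝒪ᴺ}` fixed by `U(J₁)(𝒪_v)`, `χ_v` trivial there and unitary at `z₀`.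

KERNEL only: theorems, no definition, no named fact, no `sorry`.  Cell hodgecm-mathlib, FLOOR 0, programme P4 (F4), crux item H413
(`--supports stmt-HodgeConjecture-24833`).  HC_CM is proved only modulo the printed citations until rung 0 closes; nothing here is a claim about them.

## References
* [Li1992] J.-S. Li, J. reine angew. Math. 428 (1992) 177–217 — Thm 2.1 (27) p. 184; §5 p. 206.
* [TateThesis1967] J. Tate, in Cassels–Fröhlich, *Algebraic Number Theory* (1967), Ch. XV §3.2 (`F_vˣ = ⊔_m ϖ^m 𝒪ˣ`).
* [PlatonovRapinchuk1994] V. Platonov, A. Rapinchuk, *Algebraic Groups and Number Theory* (1994), §5.1 (`G_{𝒪_v}`).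
-/

set_option autoImplicit false

noncomputable section

open NumberField IsDedekindDomain MeasureTheory Filter Set
open scoped Matrix NNReal Topology ComplexConjugate IsMulCommutative
open Literature.RepresentationTheory Literature.RepresentationTheory.HeisenbergGroup
open Literature.NumberTheory.Automorphic
open Literature.NumberTheory.Automorphic.UnitaryGroup
open Literature.NumberTheory.Automorphic.Liu2021
open Literature.NumberTheory.Weil1964

namespace Literature.NumberTheory.GelbartRogawski1991.UnitaryDualPair.LocalSplitting.FinLocalSplittings

variable {F : Type} [Field F] [NumberField F] {E : Type} [Field E] [NumberField E] [Algebra F E]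
  [Algebra.IsQuadraticExtension F E] {c : E ≃ₐ[F] E} {N : ℕ} {δ : E} {hcδ : c δ = -δ} {hδ : δ ≠ 0} {d : F}
  {hd : δ * δ = algebraMap F E d} {T : Matrix (Fin N) (Fin N) F} {hT : T.IsSymm}
  {J : Matrix (Fin N) (Fin N) E} {hJ : J = T.map (algebraMap F E)}
  (𝓢 : FinLocalSplittings F E c N hcδ hδ hd T hT hJ) (J₁ : Matrix (Fin 1) (Fin 1) E) (hJ₁ : J₁ 0 0 ≠ 0)
  (v : HeightOneSpectrum (𝓞 F))

/-! ## §1 `hcover` and `hfree` from a generator -/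

omit [Algebra.IsQuadraticExtension F E] in
/-- **`hcover` from a generator**: if every `h ∈ U(J₁)(F_v)` is `k₀ z₀^m` with `k₀` integral, then `(z₀^m)⁻¹ h ∈ U(J₁)(𝒪_v)` for some `m`
(the torus is commutative). [cite: TateThesis1967, §3.2] -/
theorem exists_zpow_inv_mul_mem_of_generates (z₀ : localPi E c 1 J₁ v)
    (hz₀ : ∀ h : localPi E c 1 J₁ v, ∃ (k₀ : localPi E c 1 J₁ v) (m : ℤ), k₀ ∈ localInt E c 1 J₁ v ∧ h = k₀ * z₀ ^ m)
    (h : localPi E c 1 J₁ v) : ∃ m : ℤ, (z₀ ^ m)⁻¹ * h ∈ localInt E c 1 J₁ v := by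
  obtain ⟨k₀, m, hk₀, rfl⟩ := hz₀ h
  refine ⟨m, ?_⟩
  rw [mul_comm k₀, inv_mul_cancel_left]
  exact hk₀

omit [Algebra.IsQuadraticExtension F E] in
/-- **`hfree` from the valuation of the generator**: if the `w`-entry of `z₀` has valuation `q_w^{∓1}` then `z₀^m ∈ U(J₁)(𝒪_v)` forces `m = 0`
(the `w`-entry of an element of `U(J₁)(𝒪_v)` has valuation `1`). [cite: PlatonovRapinchuk1994, §5.1] -/
theorem zpow_mem_localInt_imp_eq_zero (w : PlacesOver E v) (z₀ : localPi E c 1 J₁ v)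
    (hval : Valued.v ((((z₀ : LocalGLPi E 1 v) w : GL (Fin 1) (w.1.adicCompletion E)) :
        Matrix (Fin 1) (Fin 1) (w.1.adicCompletion E)) 0 0) = WithZero.exp (-1 : ℤ) ∨
      Valued.v ((((z₀ : LocalGLPi E 1 v) w : GL (Fin 1) (w.1.adicCompletion E)) :
        Matrix (Fin 1) (Fin 1) (w.1.adicCompletion E)) 0 0) = WithZero.exp (1 : ℤ))
    (m : ℤ) (hm : z₀ ^ m ∈ localInt E c 1 J₁ v) : m = 0 := by
  -- the `w`-component of `z₀^m` is integral, hence its determinant (= its entry) has valuation `1`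
  have hint : ((z₀ ^ m : localPi E c 1 J₁ v) : LocalGLPi E 1 v) w ∈ glInt 1 (w.1.adicCompletion E) :=
    (mem_localInt_iff E c 1 J₁ v (z₀ ^ m)).1 hm w
  have hdet1 := (valued_det_eq_one_iff_mem_glInt_one _).2 hint
  have hζ : ∀ u : localPi E c 1 J₁ v, ((Matrix.GeneralLinearGroup.det ((u : LocalGLPi E 1 v) w) : (w.1.adicCompletion E)ˣ) :
      w.1.adicCompletion E) = (((u : LocalGLPi E 1 v) w : GL (Fin 1) (w.1.adicCompletion E)) :
        Matrix (Fin 1) (Fin 1) (w.1.adicCompletion E)) 0 0 := fun u => by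
    rw [Matrix.GeneralLinearGroup.val_det_apply, Matrix.det_fin_one]
  have hpow : ((z₀ ^ m : localPi E c 1 J₁ v) : LocalGLPi E 1 v) w = (((z₀ : localPi E c 1 J₁ v) : LocalGLPi E 1 v) w) ^ m := by
    rw [Subgroup.coe_zpow, Pi.pow_apply]
  rw [hpow, map_zpow, Units.val_zpow_eq_zpow_val, map_zpow₀, hζ] at hdet1
  -- `x^m = 1` with `x = exp(∓1)` forces `m = 0`
  rcases hval with hx | hx
  · rw [hx, ← WithZero.exp_zsmul, smul_eq_mul, mul_neg, mul_one, ← WithZero.exp_zero] at hdet1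
    have := WithZero.exp_injective hdet1
    omega
  · rw [hx, ← WithZero.exp_zsmul, smul_eq_mul, mul_one, ← WithZero.exp_zero] at hdet1
    exact WithZero.exp_injective hdet1

/-! ## §2 The split unramified local factor from a generator -/

variable [MeasurableSpace (localPi E c 1 J₁ v)] [BorelSpace (localPi E c 1 J₁ v)]
  (dh : Measure (localPi E c 1 J₁ v)) [dh.IsMulLeftInvariant] [IsFiniteMeasureOnCompacts dh] [dh.IsOpenPosMeasure]
  [MeasurableSpace (Fin N → v.adicCompletion F)] (μX : Measure (Fin N → v.adicCompletion F))
  (χv : localPi E c 1 J₁ v →* ℂˣ)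

/-- **THE SPLIT UNRAMIFIED LOCAL FACTOR OF (27) FROM A GENERATOR.**  At a place `v` with a split `w ∣ v`, let `z₀` generate `U(J₁)(F_v)` over
`U(J₁)(𝒪_v)` (`hz₀`) with `w`-entry of valuation `q_w^{∓1}`; suppose `U(J₁)(𝒪_v)` fixes `1_{𝒪_vᴺ}` through the centre, `χ_v` is trivial on
`U(J₁)(𝒪_v)` and unitary at `z₀`, and the spherical matrix coefficients along `z₀` are `C u^m r^{|m|}` (`C ≠ 0`, `|u| = 1`, `0 ≤ r < 1`).  Then
`∫_{U(J₁)(F_v)} ⟨ω_v(h·1)1_{𝒪ᴺ}, 1_{𝒪ᴺ}⟩ conj χ_v(h) dh = dh(U(J₁)(𝒪_v)) · C · (1 − r²) ∕ |1 − u conj χ_v(z₀) r|² ≠ 0`, for any left-invariant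
measure `dh` finite on compacts and charging open sets. [cite: Li1992, Thm 2.1 (27) p. 184; §5 p. 206] [cite: TateThesis1967, §3.2, §4.2] -/
theorem integral_localFactor_unitVec_ne_zero_of_generates (w : PlacesOver E v) (z₀ : localPi E c 1 J₁ v)
    (hz₀ : ∀ h : localPi E c 1 J₁ v, ∃ (k₀ : localPi E c 1 J₁ v) (m : ℤ), k₀ ∈ localInt E c 1 J₁ v ∧ h = k₀ * z₀ ^ m)
    (hval : Valued.v ((((z₀ : LocalGLPi E 1 v) w : GL (Fin 1) (w.1.adicCompletion E)) :
        Matrix (Fin 1) (Fin 1) (w.1.adicCompletion E)) 0 0) = WithZero.exp (-1 : ℤ) ∨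
      Valued.v ((((z₀ : LocalGLPi E 1 v) w : GL (Fin 1) (w.1.adicCompletion E)) :
        Matrix (Fin 1) (Fin 1) (w.1.adicCompletion E)) 0 0) = WithZero.exp (1 : ℤ))
    (hfix : ∀ k ∈ localInt E c 1 J₁ v, 𝓢.omegaLoc v (localCenter E c N J J₁ hJ₁ v k) (unitVec F (Fin N) v) = unitVec F (Fin N) v)
    (hχK : ∀ k ∈ localInt E c 1 J₁ v, χv k = 1) (hχu : ‖((χv z₀ : ℂˣ) : ℂ)‖ = 1)
    {C u : ℂ} (hC : C ≠ 0) (hu : ‖u‖ = 1) {r : ℝ} (hr0 : 0 ≤ r) (hr1 : r < 1)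
    (hcoef : ∀ m : ℤ, ∫ x, ((𝓢.omegaLoc v (localCenter E c N J J₁ hJ₁ v (z₀ ^ m)) (unitVec F (Fin N) v) :
          ↥(SchwartzBruhat (Fin N → v.adicCompletion F))) : (Fin N → v.adicCompletion F) → ℂ) x *
        conj (((unitVec F (Fin N) v : ↥(SchwartzBruhat (Fin N → v.adicCompletion F))) : (Fin N → v.adicCompletion F) → ℂ) x) ∂μX =
        C * u ^ m * (r : ℂ) ^ m.natAbs) :
    (∫ h, (∫ x, ((𝓢.omegaLoc v (localCenter E c N J J₁ hJ₁ v h) (unitVec F (Fin N) v) :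
            ↥(SchwartzBruhat (Fin N → v.adicCompletion F))) : (Fin N → v.adicCompletion F) → ℂ) x *
          conj (((unitVec F (Fin N) v : ↥(SchwartzBruhat (Fin N → v.adicCompletion F))) : (Fin N → v.adicCompletion F) → ℂ) x) ∂μX) *
        conj (((χv h : ℂˣ) : ℂ)) ∂dh =
        (dh.real (localInt E c 1 J₁ v : Set (localPi E c 1 J₁ v)) : ℂ) * C *
          (((1 - r ^ 2) / ‖1 - (u * conj ((χv z₀ : ℂˣ) : ℂ)) * r‖ ^ 2 : ℝ) : ℂ)) ∧
    (∫ h, (∫ x, ((𝓢.omegaLoc v (localCenter E c N J J₁ hJ₁ v h) (unitVec F (Fin N) v) :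
            ↥(SchwartzBruhat (Fin N → v.adicCompletion F))) : (Fin N → v.adicCompletion F) → ℂ) x *
          conj (((unitVec F (Fin N) v : ↥(SchwartzBruhat (Fin N → v.adicCompletion F))) : (Fin N → v.adicCompletion F) → ℂ) x) ∂μX) *
        conj (((χv h : ℂˣ) : ℂ)) ∂dh) ≠ 0 := by
  have hcover := exists_zpow_inv_mul_mem_of_generates J₁ v z₀ hz₀
  have hfree := zpow_mem_localInt_imp_eq_zero J₁ v w z₀ hval
  refine ⟨(𝓢.integral_localFactor_unitVec_of_sphericalCoeff J₁ hJ₁ v dh μX χv z₀ hcover hfree hfix hχK hχu hu hr0 hr1 hcoef).2, ?_⟩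
  refine 𝓢.integral_localFactor_unitVec_ne_zero_of_sphericalCoeff J₁ hJ₁ v dh μX χv z₀ hcover hfree hfix hχK hχu hC hu hr0 hr1 hcoef ?_
  exact ((isOpen_localInt E c 1 J₁ v).measure_pos dh ⟨1, Subgroup.one_mem _⟩).ne'

end Literature.NumberTheory.GelbartRogawski1991.UnitaryDualPair.LocalSplitting.FinLocalSplittings

end
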